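import Summits.CriticalPhenomena.PercolationContinuityZ3.Theorems.PercNearOneGluingNoHeavyLowerTailAntipodalR1PocketFlip
import Summits.CriticalPhenomena.PercolationContinuityZ3.Theorems.PercNearOneGluingNoHeavyLowerTailAntipodalR1TwoCutComponents
import HarnessLib

/-!
# The pocket flip, II: the pocket flip preserves the grade `k(O) + k(K)`

Support file for `stmt-CriticalPhenomena-4575` (memo `prim-gen-kcluster/KCLUSTER-gen79.md` §1; conjecture
ANTI₁-GRADED of `KCLUSTER-gen52.md` §3).  No definitions, no named facts, no sorries.  Continuation of
`…AntipodalR1PocketFlip`: `Q = region ends x a c` is the pocket of `c`, `y = Φ_c(x)` the colouring with every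
edge touching `Q` reversed.  Grades as in `…AntipodalR1NestedGraded`:
`g(x) = #CC(fromEdgeSet {s | ∃ e, x e = true ∧ ends e = s}) + #CC(fromEdgeSet {s | ∃ e, x e = false ∧ ends e = s})`.

**Theorem** (`AntipodalR1.grade_pocketFlip`): if `c ∉ K_a(x)` and the pocket is singly attached (every vertex
outside `Q` adjacent to `Q` is joined to `a` by an open path of `x` avoiding `Q`), then `g(Φ_c(x)) = g(x)`.

Proof.  For an edge set `S ⊆ Sym2 V` and a vertex set `I` split `S` into the edges touching `I` and the others;
if the graph `fromEdgeSet S` and its non-touching part have the same reachability between vertices outside `I`,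
then `#CC(fromEdgeSet S) + #I = #CC(non-touching part) + #{components of the touching part inside I}` (part VI's
abstract counting lemma `AntipodalR1.card_cc_add_card_eq`; here `AntipodalR1.card_cc_touch_split`).  Same
reachability holds when no edge of `S` leaves `I` (`reachable_off_iff_of_sealed`) and when every outside end of an
edge of `S` leaving `I` is joined to one fixed vertex in the non-touching part (`reachable_off_iff_of_attached`).
With `I = Q`: the closed graph of `x` and the open graph of `y` are sealed (closed edges of `x` touching `Q` lie
inside `Q`); the open graph of `x` is attached by hypothesis and the closed graph of `y` is attached because the
outside ends lie in `K_a(x)`.  The non-touching parts of the graphs of `y` are those of `x`, and the touching parts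
are exchanged; summing the four identities gives `g(y) = g(x)`.  [this work]
-/

namespace Summit.CriticalPhenomena.PercolationContinuityZ3.Theorems

namespace AntipodalR1

open Finset Relation SimpleGraph

variable {V ι : Type*}

/-! ### Splitting an edge set along a vertex set -/

section Abstract

variable {S : Set (Sym2 V)} {I : Set V}

/-- An invariant preserved along every edge is preserved along every walk. [this work] -/
theorem walk_invariant {H : SimpleGraph V} (P : V → Prop) (hstep : ∀ u v, H.Adj u v → P u → P v)
    {u w : V} (p : H.Walk u w) (hu : P u) : P w := by
  induction p with
  | nil => exact hu
  | cons hadj _ ih => exact ih (hstep _ _ hadj hu)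

/-- The non-touching part of an edge set is a subgraph. [this work] -/
theorem fromEdgeSet_notouch_le (S : Set (Sym2 V)) (I : Set V) :
    fromEdgeSet {s | s ∈ S ∧ ∀ v, v ∈ s → v ∉ I} ≤ fromEdgeSet S :=
  fromEdgeSet_mono fun _ hs => hs.1

/-- **Sealed case.**  If no edge of `S` leaves `I`, reachability between vertices outside `I` is the same in
`fromEdgeSet S` and in its non-touching part. [this work] -/
theorem reachable_off_iff_of_sealed (hseal : ∀ u v, s(u, v) ∈ S → u ∈ I → v ∈ I) (x y : V)
    (hx : x ∉ I) (_hy : y ∉ I) :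
    (fromEdgeSet S).Reachable x y ↔ (fromEdgeSet {s | s ∈ S ∧ ∀ v, v ∈ s → v ∉ I}).Reachable x y := by
  constructor
  · rintro ⟨p⟩
    have key : y ∉ I ∧ (fromEdgeSet {s | s ∈ S ∧ ∀ v, v ∈ s → v ∉ I}).Reachable x y := by
      refine walk_invariant (fun v => v ∉ I ∧
        (fromEdgeSet {s | s ∈ S ∧ ∀ v, v ∈ s → v ∉ I}).Reachable x v) ?_ p ⟨hx, Reachable.refl _⟩
      rintro u v hadj ⟨huI, hxu⟩
      rw [fromEdgeSet_adj] at hadj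
      obtain ⟨huv, hne⟩ := hadj
      have hvI : v ∉ I := fun hvI => huI (hseal v u (by rw [Sym2.eq_swap]; exact huv) hvI)
      have hadj' : (fromEdgeSet {s | s ∈ S ∧ ∀ v, v ∈ s → v ∉ I}).Adj u v := by
        rw [fromEdgeSet_adj]
        refine ⟨⟨huv, fun w hw => ?_⟩, hne⟩
        rcases Sym2.mem_iff.1 hw with rfl | rfl
        · exact huI
        · exact hvI
      exact ⟨hvI, hxu.trans hadj'.reachable⟩
    exact key.2
  · exact fun h => h.mono (fromEdgeSet_notouch_le S I)

/-- **Attached case.**  If every outside end of an edge of `S` leaving `I` is joined to a fixed vertex `a ∉ I`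
in the non-touching part, reachability between vertices outside `I` is the same in `fromEdgeSet S` and in its
non-touching part. [this work] -/
theorem reachable_off_iff_of_attached (a : V)
    (hatt : ∀ u v, s(u, v) ∈ S → u ≠ v → v ∈ I → u ∉ I →
      (fromEdgeSet {s | s ∈ S ∧ ∀ v, v ∈ s → v ∉ I}).Reachable a u)
    (x y : V) (hx : x ∉ I) (hy : y ∉ I) :
    (fromEdgeSet S).Reachable x y ↔ (fromEdgeSet {s | s ∈ S ∧ ∀ v, v ∈ s → v ∉ I}).Reachable x y := by
  constructor
  · rintro ⟨p⟩
    have key : (y ∉ I → (fromEdgeSet {s | s ∈ S ∧ ∀ v, v ∈ s → v ∉ I}).Reachable x y) ∧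
        (y ∈ I → (fromEdgeSet {s | s ∈ S ∧ ∀ v, v ∈ s → v ∉ I}).Reachable x a) := by
      refine walk_invariant (fun v => (v ∉ I → (fromEdgeSet {s | s ∈ S ∧ ∀ v, v ∈ s → v ∉ I}).Reachable x v) ∧
        (v ∈ I → (fromEdgeSet {s | s ∈ S ∧ ∀ v, v ∈ s → v ∉ I}).Reachable x a)) ?_ p
        ⟨fun _ => Reachable.refl _, fun h => absurd h hx⟩
      rintro u v hadj ⟨h1, h2⟩
      rw [fromEdgeSet_adj] at hadj
      obtain ⟨huv, hne⟩ := hadj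
      refine ⟨fun hvI => ?_, fun hvI => ?_⟩
      · by_cases huI : u ∈ I
        · exact (h2 huI).trans (hatt v u (by rw [Sym2.eq_swap]; exact huv) hne.symm huI hvI)
        · have hadj' : (fromEdgeSet {s | s ∈ S ∧ ∀ v, v ∈ s → v ∉ I}).Adj u v := by
            rw [fromEdgeSet_adj]
            refine ⟨⟨huv, fun w hw => ?_⟩, hne⟩
            rcases Sym2.mem_iff.1 hw with rfl | rfl
            · exact huI
            · exact hvI
          exact (h1 huI).trans hadj'.reachable
      · by_cases huI : u ∈ I
        · exact h2 huI
        · exact (h1 huI).trans (hatt u v huv hne hvI huI).symm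
    exact key.1 hy
  · exact fun h => h.mono (fromEdgeSet_notouch_le S I)

/-- **Component count split along a vertex set.**  If `fromEdgeSet S` and its non-touching part have the
same reachability off `I`, then `#CC(fromEdgeSet S) + #I = #CC(non-touching part) + #{components of the
touching part inside I}`. [this work] -/
theorem card_cc_touch_split [Finite V]
    (hreach : ∀ x y, x ∉ I → y ∉ I →
      ((fromEdgeSet S).Reachable x y ↔ (fromEdgeSet {s | s ∈ S ∧ ∀ v, v ∈ s → v ∉ I}).Reachable x y)) :
    Nat.card (fromEdgeSet S).ConnectedComponent + Nat.card I =
      Nat.card (fromEdgeSet {s | s ∈ S ∧ ∀ v, v ∈ s → v ∉ I}).ConnectedComponent +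
        Nat.card {D : (fromEdgeSet {s | s ∈ S ∧ ∃ v, v ∈ s ∧ v ∈ I}).ConnectedComponent //
          ¬ ∃ x, x ∉ I ∧ (fromEdgeSet {s | s ∈ S ∧ ∃ v, v ∈ s ∧ v ∈ I}).connectedComponentMk x = D} := by
  refine card_cc_add_card_eq _ _ _ I hreach ?_ (fromEdgeSet_mono fun _ hs => hs.1) ?_
  · intro w hw z hadj
    rw [fromEdgeSet_adj] at hadj
    exact hadj.1.2 w (Sym2.mem_mk_left _ _) hw
  · intro w hw z hadj
    rw [fromEdgeSet_adj] at hadj ⊢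
    exact ⟨⟨hadj.1, w, Sym2.mem_mk_left _ _, hw⟩, hadj.2⟩

end Abstract

/-! ### The grade of the pocket flip -/

section Grade

variable [Finite V] {ends : ι → Sym2 V} {x y : ι → Bool} {a c : V}

omit [Finite V] in
/-- An open path of `x` avoiding the pocket is a path of the non-touching open graph. [this work] -/
theorem reachable_notouch_of_path {v : V}
    (hv : ReflTransGen (fun u w => w ∈ nbr ends x true u ∧
      u ∉ region ends x a c ∧ w ∉ region ends x a c) a v) :
    (fromEdgeSet {s | s ∈ {s : Sym2 V | ∃ e, x e = true ∧ ends e = s} ∧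
      ∀ w, w ∈ s → w ∉ region ends x a c}).Reachable a v := by
  induction hv with
  | refl => exact Reachable.refl _
  | @tail u w _ huw ih =>
    obtain ⟨⟨e, hxe, he⟩, huQ, hwQ⟩ := huw
    by_cases huw' : u = w
    · exact huw' ▸ ih
    · refine ih.trans (Adj.reachable ?_)
      rw [fromEdgeSet_adj]
      refine ⟨⟨⟨e, hxe, he⟩, fun z hz => ?_⟩, huw'⟩
      rcases Sym2.mem_iff.1 hz with rfl | rfl
      · exact huQ
      · exact hwQ

omit [Finite V] in
/-- `K_a(x)` lies in one component of the non-touching closed graph of `x`. [this work] -/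
theorem reachable_notouch_of_mem_clus_false (hc : c ∉ clus ends x false a) {v : V}
    (hv : v ∈ clus ends x false a) :
    (fromEdgeSet {s | s ∈ {s : Sym2 V | ∃ e, x e = false ∧ ends e = s} ∧
      ∀ w, w ∈ s → w ∉ region ends x a c}).Reachable a v := by
  rw [mem_clus] at hv
  induction hv with
  | refl => exact Reachable.refl _
  | @tail u w hau huw ih =>
    obtain ⟨e, hxe, he⟩ := huw
    by_cases huw' : u = w
    · exact huw' ▸ ih
    · refine ih.trans (Adj.reachable ?_)
      rw [fromEdgeSet_adj]
      refine ⟨⟨⟨e, hxe, he⟩, fun z hz hzQ => ?_⟩, huw'⟩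
      have huQ : u ∈ region ends x a c :=
        mem_pocket_of_touch_closed hc ⟨z, by rw [he]; exact hz, hzQ⟩ hxe (by rw [he]; exact Sym2.mem_mk_left _ _)
      exact not_mem_clus_of_region hc huQ hau

open Classical in
/-- **The pocket flip preserves the grade** on singly attached colourings. [this work] -/
theorem grade_pocketFlip (hc : c ∉ clus ends x false a)
    (hy : ∀ e, y e = if (∃ v, v ∈ ends e ∧ v ∈ region ends x a c) then !x e else x e)
    (hatt : ∀ w, w ∉ region ends x a c → (∃ e u, ends e = s(w, u) ∧ u ∈ region ends x a c) →
      ReflTransGen (fun u w => w ∈ nbr ends x true u ∧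
        u ∉ region ends x a c ∧ w ∉ region ends x a c) a w) :
    Nat.card (fromEdgeSet {s : Sym2 V | ∃ e, y e = true ∧ ends e = s}).ConnectedComponent +
        Nat.card (fromEdgeSet {s : Sym2 V | ∃ e, y e = false ∧ ends e = s}).ConnectedComponent =
      Nat.card (fromEdgeSet {s : Sym2 V | ∃ e, x e = true ∧ ends e = s}).ConnectedComponent +
        Nat.card (fromEdgeSet {s : Sym2 V | ∃ e, x e = false ∧ ends e = s}).ConnectedComponent := by
  set A : Set (Sym2 V) := {s | ∃ e, x e = true ∧ ends e = s} with hA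
  set B : Set (Sym2 V) := {s | ∃ e, x e = false ∧ ends e = s} with hB
  set A' : Set (Sym2 V) := {s | ∃ e, y e = true ∧ ends e = s} with hA'
  set B' : Set (Sym2 V) := {s | ∃ e, y e = false ∧ ends e = s} with hB'
  -- touching / non-touching in terms of an edge label
  have touch_iff : ∀ {e : ι} {s : Sym2 V}, ends e = s →
      ((∃ v, v ∈ s ∧ v ∈ region ends x a c) ↔ ∃ v, v ∈ ends e ∧ v ∈ region ends x a c) := by
    intro e s he; rw [he]
  -- the four edge-set identities
  have hE1 : {s | s ∈ A' ∧ ∀ v, v ∈ s → v ∉ region ends x a c} = {s | s ∈ A ∧ ∀ v, v ∈ s → v ∉ region ends x a c} := by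
    ext s
    simp only [Set.mem_setOf_eq, hA', hA]
    constructor
    · rintro ⟨⟨e, hye, he⟩, hnt⟩
      have hnt' : ¬ ∃ v, v ∈ ends e ∧ v ∈ region ends x a c := fun ⟨v, hv, hvQ⟩ =>
        hnt v (he ▸ hv) hvQ
      exact ⟨⟨e, by rw [← pocketFlip_of_not_touch hy hnt']; exact hye, he⟩, hnt⟩
    · rintro ⟨⟨e, hxe, he⟩, hnt⟩
      have hnt' : ¬ ∃ v, v ∈ ends e ∧ v ∈ region ends x a c := fun ⟨v, hv, hvQ⟩ =>
        hnt v (he ▸ hv) hvQ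
      exact ⟨⟨e, by rw [pocketFlip_of_not_touch hy hnt']; exact hxe, he⟩, hnt⟩
  have hE2 : {s | s ∈ B' ∧ ∀ v, v ∈ s → v ∉ region ends x a c} = {s | s ∈ B ∧ ∀ v, v ∈ s → v ∉ region ends x a c} := by
    ext s
    simp only [Set.mem_setOf_eq, hB', hB]
    constructor
    · rintro ⟨⟨e, hye, he⟩, hnt⟩
      have hnt' : ¬ ∃ v, v ∈ ends e ∧ v ∈ region ends x a c := fun ⟨v, hv, hvQ⟩ =>
        hnt v (he ▸ hv) hvQ
      exact ⟨⟨e, by rw [← pocketFlip_of_not_touch hy hnt']; exact hye, he⟩, hnt⟩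
    · rintro ⟨⟨e, hxe, he⟩, hnt⟩
      have hnt' : ¬ ∃ v, v ∈ ends e ∧ v ∈ region ends x a c := fun ⟨v, hv, hvQ⟩ =>
        hnt v (he ▸ hv) hvQ
      exact ⟨⟨e, by rw [pocketFlip_of_not_touch hy hnt']; exact hxe, he⟩, hnt⟩
  have hE3 : {s | s ∈ A' ∧ ∃ v, v ∈ s ∧ v ∈ region ends x a c} = {s | s ∈ B ∧ ∃ v, v ∈ s ∧ v ∈ region ends x a c} := by
    ext s
    simp only [Set.mem_setOf_eq, hA', hB]
    constructor
    · rintro ⟨⟨e, hye, he⟩, ht⟩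
      have ht' : ∃ v, v ∈ ends e ∧ v ∈ region ends x a c := (touch_iff he).1 ht
      have hxe : x e = false := by
        rw [pocketFlip_of_touch hy ht'] at hye
        cases hxe : x e
        · rfl
        · rw [hxe] at hye; exact absurd hye (by decide)
      exact ⟨⟨e, hxe, he⟩, ht⟩
    · rintro ⟨⟨e, hxe, he⟩, ht⟩
      have ht' : ∃ v, v ∈ ends e ∧ v ∈ region ends x a c := (touch_iff he).1 ht
      exact ⟨⟨e, by rw [pocketFlip_of_touch hy ht', hxe]; rfl, he⟩, ht⟩
  have hE4 : {s | s ∈ B' ∧ ∃ v, v ∈ s ∧ v ∈ region ends x a c} = {s | s ∈ A ∧ ∃ v, v ∈ s ∧ v ∈ region ends x a c} := by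
    ext s
    simp only [Set.mem_setOf_eq, hB', hA]
    constructor
    · rintro ⟨⟨e, hye, he⟩, ht⟩
      have ht' : ∃ v, v ∈ ends e ∧ v ∈ region ends x a c := (touch_iff he).1 ht
      have hxe : x e = true := by
        rw [pocketFlip_of_touch hy ht'] at hye
        cases hxe : x e
        · rw [hxe] at hye; exact absurd hye (by decide)
        · rfl
      exact ⟨⟨e, hxe, he⟩, ht⟩
    · rintro ⟨⟨e, hxe, he⟩, ht⟩
      have ht' : ∃ v, v ∈ ends e ∧ v ∈ region ends x a c := (touch_iff he).1 ht
      exact ⟨⟨e, by rw [pocketFlip_of_touch hy ht', hxe]; rfl, he⟩, ht⟩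
  -- (1) open graph of `x`: attached
  have h1 := card_cc_touch_split (S := A) (I := region ends x a c) (reachable_off_iff_of_attached a (fun u v huv _ hvQ huQ => by
    obtain ⟨e, _, he⟩ := huv
    exact reachable_notouch_of_path (hatt u huQ ⟨e, v, he, hvQ⟩)))
  -- (2) closed graph of `x`: sealed
  have h2 := card_cc_touch_split (S := B) (I := region ends x a c) (reachable_off_iff_of_sealed (fun u v huv huQ => by
    obtain ⟨e, hxe, he⟩ := huv
    exact mem_pocket_of_touch_closed hc ⟨u, by rw [he]; exact Sym2.mem_mk_left _ _, huQ⟩ hxe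
      (by rw [he]; exact Sym2.mem_mk_right _ _)))
  -- (3) open graph of `y`: sealed
  have h3 := card_cc_touch_split (S := A') (I := region ends x a c) (reachable_off_iff_of_sealed (fun u v huv huQ => by
    obtain ⟨e, hye, he⟩ := huv
    have ht : ∃ v, v ∈ ends e ∧ v ∈ region ends x a c := ⟨u, by rw [he]; exact Sym2.mem_mk_left _ _, huQ⟩
    have hxe : x e = false := by
      rw [pocketFlip_of_touch hy ht] at hye
      cases hxe : x e
      · rfl
      · rw [hxe] at hye; exact absurd hye (by decide)
    exact mem_pocket_of_touch_closed hc ht hxe (by rw [he]; exact Sym2.mem_mk_right _ _)))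
  -- (4) closed graph of `y`: attached (outside ends lie in `K_a(x)`)
  have h4 := card_cc_touch_split (S := B') (I := region ends x a c) (reachable_off_iff_of_attached a (fun u v huv _ hvQ huQ => by
    obtain ⟨e, _, he⟩ := huv
    rw [hE2]
    exact reachable_notouch_of_mem_clus_false hc
      (mem_clus_of_adj_pocket hc hvQ (by rw [he, Sym2.eq_swap]) huQ)))
  rw [hE1, hE3] at h3
  rw [hE2, hE4] at h4
  omega

end Grade

end AntipodalR1

end Summit.CriticalPhenomena.PercolationContinuityZ3.Theorems
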